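import Literature.NumberTheory.Automorphic.AdelicUnitaryGroupDatum
import Literature.NumberTheory.Automorphic.UnitaryGroupAdelicProduct
import Literature.NumberTheory.Automorphic.GLnCuspidalSpectrumSiegel
import Literature.NumberTheory.Automorphic.AutomorphicRepsGLCuspidalKFiniteGarding
import Literature.NumberTheory.Automorphic.LocalUnitaryIntegralLevel
import HarnessLib

/-!
# Test functions on the adelic unitary group `U(H)(𝔸_{L⁺})`, pure tensors, and local transfer away from the bad places
# (the function class the ENGINE T1 trace-formula kit quantifies over; [Rogawski1990] §14.2)

Topic `NumberTheory/Rogawski1990`; namespace `Literature.NumberTheory.Automorphic.UnitaryGroup`.  DEFINITIONS WITH BODIES + lemmas +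
one closed statement (`LocalTransferAway`, a RELATION, not a fact); no `sorry`, no instance, no notation.  Spec: F0P3a-plan (g0)
`F0/P3a/LETTER-WANTED-TestFunctions.F0P3a-plan-g0.md` (aede274e), integrator ruling F0P3-plan (g0) 22:18:40Z (c).  This file TYPES the
test-function class; it proves nothing about traces.  HC_CM is proved only modulo the printed citations until rung 0 closes.

DESIGN (cheapest honest route, BY RESTRICTION from the ★ `GL` class).  `(UnitaryGroup.cmDatum L N H).Adelic = ↥(adelicUnitaryGroup L H)`
(★ `AdelicUnitaryGroupDatum`, `cmDatum_Adelic`, `rfl`) is a CLOSED subgroup of `GL_N(𝔸_L)` (★ `isClosed_adelicUnitaryGroup`).  The tree's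
Garrett class ★ `IsTestFunctionGL N L η` (`GLnCuspidalSpectrumSiegel`: continuous, compactly supported, smooth in the archimedean variable,
right-invariant under an admissible finite level) is real-valued; a complex function on `U(H)(𝔸_{L⁺})` is a TEST FUNCTION iff its real
and imaginary parts are restrictions of `GL`-test functions ([Rogawski1990] §14.2: `f′ ∈ C_c^∞(G′(𝔸))`; [Garrett2018, §6.3]; [BorelJacquet1979,
§4.1]).  Consumers only use members as hypotheses (the converse «every smooth compactly supported function on the closed subgroup extends»
is never needed).

* §1 `UnitaryGroup.IsTestFunction L N H f` (L1) + `continuous`, `hasCompactSupport`, `add`, `const_mul` (complex scalars), `zero`, `neg`.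
* §2 `UnitaryGroup.PureTensor L N H` (L2): FACTORIZABLE test data — a finite bad set `S` of finite places of `L⁺`, a family of
  UNRAMIFIED LEVELS `K v ≤ U(H)(L⁺_v)` (DATA supplied by the consumer: the hyperspecial∕integral stabilisers — the tree has the adelic
  integral level ★ `finAdelicIntegralLevel` but no per-place token in `(cmDatum L N H).Local v` yet, so the level family is a FIELD, SAID
  SO here per the spec), local factors `loc v : U(H)(L⁺_v) → ℂ` equal to the indicator of `K v` off `S`, and an archimedean factor
  `arch : U(H)(L⁺ ⊗ ℝ) → ℂ` read through ★ `archPart` (`g ↦ g_∞`); `eval g := 1_{∀ v ∉ S, g_v ∈ K v} · arch(g_∞) · ∏_{v ∈ S} loc v (g_v)`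
  (the restricted product of the local factors), with `eval_eq_of_forall_mem` ∕ `eval_eq_zero_of_not_mem`.  NOT here (deferred to ed. 2,
  when a per-place integral-level token lands): «pure tensors with smooth compactly supported factors are test functions» — it is TRUE only
  when `K v` is the integral level at almost all `v` (restricted-product topology), which the abstract field cannot express.
* §3 `UnitaryGroup.LocalTransferAway ψ T T′ S₀bad` (L3): the RELATION «for `v ∉ S₀bad`, `f′_v = f_v` along the local identifications
  `ψ_v : G′_v ≃ G_v`» ([Rogawski1990] §14.2 p. 233: «for `v ∉ S₀ ∪ S` … we identify `G′_v` and `G_v` … `f_v = f′_v`»), a closed `Prop`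
  relating two pure tensors on two forms `H`, `H′`; nothing at `S₀`∕`∞` (the transfer-factor layer, T1-tf).
* §4 (EDITION 2, F0-typ1 (g2), after ★ `LocalUnitaryIntegralLevel` (F0P3a-p03 (g0), p794090) supplied the per-place token
  `cmLocalIntegralLevel L N H v = U(H)(𝒪_v) ≤ (cmDatum L N H).Local v`): the HYPOTHESES under which a pure tensor is a test function —
  `T.IsUnramified` (off `S` the level `K v` IS `U(H)(𝒪_v)`, so `f_v = 1_{U(H)(𝒪_v)}` for almost all `v`, [Rogawski1990] §14.2 p. 233),
  `T.IsFinSmooth` (the bad local factors are locally constant with compact support, `f_v ∈ C_c^∞(G_v)`), `T.IsArchTest` (the archimedean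
  factor is the restriction along the closed subgroup `U(H)(L⁺ ⊗ ℝ) ≤ GL_N(L ⊗ ℝ)` of a continuous, compactly supported, right-translation
  smooth function — ★ `IsArchSmooth` for ★ `archGroupGL`, the same BY-RESTRICTION reading as §1), bundled as `T.IsTest`; the smart
  constructor `PureTensor.ofUnramified` (levels := the integral levels); and the API every local factor of an `IsTest` tensor is locally
  constant ∕ compactly supported, the archimedean factor continuous and compactly supported.  The THEOREM «`T.IsTest → IsTestFunction L N H
  T.eval`» (restricted-product continuity + extension from the closed subgroup) is PROVER work (F0P3a B10), deliberately NOT stated here as a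
  named fact; §§1–3 are byte-identical to edition 1.

## References
* [Rogawski1990] J. Rogawski, Ann. of Math. Stud. 123 (1990), §14.2 p. 233 (the functions `f′ = ⊗ f′_v` on `G′(𝔸)`, `f_v = f′_v` off
  `S₀ ∪ S`), §14.5–14.6.
* [Garrett2018] P. Garrett, *Modern analysis of automorphic forms by example* (2018), §6.3 (test functions on adele groups).
* [BorelJacquet1979] A. Borel, H. Jacquet, Corvallis PSPM 33.1 (1979), §4.1.
-/

noncomputable section

open NumberField IsDedekindDomain
open scoped Classical

namespace Literature.NumberTheory.Automorphic.UnitaryGroup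

variable (L : Type) [Field L] [NumberField L] [IsCMField L] (N : ℕ) (H : Matrix (Fin N) (Fin N) L)

/-! ## §1 Test functions on `U(H)(𝔸_{L⁺})` by restriction from `GL_N(𝔸_L)` -/

/-- **`IsTestFunction L N H f` — `f : U(H)(𝔸_{L⁺}) → ℂ` is a TEST FUNCTION**: its real and imaginary parts are restrictions, along
`U(H)(𝔸_{L⁺}) = adelicUnitaryGroup L H ≤ GL_N(𝔸_L)`, of Garrett test functions on `GL_N(𝔸_L)` (★ `IsTestFunctionGL N L`: continuous,
compactly supported, archimedean-smooth, right-invariant under an admissible finite level).  This is the class `C_c^∞(G′(𝔸))` of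
[Rogawski1990] §14.2 read by restriction. [cite: Rogawski1990, §14.2 p. 233] [cite: Garrett2018, §6.3] [cite: BorelJacquet1979, §4.1] -/
def IsTestFunction (f : (cmDatum L N H).Adelic → ℂ) : Prop :=
  ∃ (η₁ η₂ : GL (Fin N) (AdeleRing (𝓞 L) L) → ℝ), IsTestFunctionGL N L η₁ ∧ IsTestFunctionGL N L η₂ ∧
    ∀ g : adelicUnitaryGroup L H,
      f g = ((η₁ (g : GL (Fin N) (AdeleRing (𝓞 L) L))) : ℂ) + ((η₂ (g : GL (Fin N) (AdeleRing (𝓞 L) L))) : ℂ) * Complex.I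

namespace IsTestFunction

variable {L N H}

/-- A test function is continuous (restriction of continuous functions along the continuous inclusion). [cite: Garrett2018, §6.3] -/
theorem continuous {f : (cmDatum L N H).Adelic → ℂ} (hf : IsTestFunction L N H f) : Continuous f := by
  obtain ⟨η₁, η₂, h₁, h₂, hf⟩ := hf
  have hc : Continuous fun g : adelicUnitaryGroup L H =>
      ((η₁ (g : GL (Fin N) (AdeleRing (𝓞 L) L))) : ℂ) + ((η₂ (g : GL (Fin N) (AdeleRing (𝓞 L) L))) : ℂ) * Complex.I :=
    (Complex.continuous_ofReal.comp (h₁.continuous.comp continuous_subtype_val)).add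
      ((Complex.continuous_ofReal.comp (h₂.continuous.comp continuous_subtype_val)).mul continuous_const)
  have e : f = fun g : adelicUnitaryGroup L H =>
      ((η₁ (g : GL (Fin N) (AdeleRing (𝓞 L) L))) : ℂ) + ((η₂ (g : GL (Fin N) (AdeleRing (𝓞 L) L))) : ℂ) * Complex.I :=
    funext fun g => hf g
  rw [e]
  exact hc

/-- A test function has compact support: `U(H)(𝔸_{L⁺})` is CLOSED in `GL_N(𝔸_L)` (★ `isClosed_adelicUnitaryGroup`), so restriction
along the closed embedding preserves compact support. [cite: Garrett2018, §6.3] [cite: BorelJacquet1979, §4.1] -/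
theorem hasCompactSupport {f : (cmDatum L N H).Adelic → ℂ} (hf : IsTestFunction L N H f) : HasCompactSupport f := by
  obtain ⟨η₁, η₂, h₁, h₂, hf⟩ := hf
  have hemb : Topology.IsClosedEmbedding (fun g : adelicUnitaryGroup L H => (g : GL (Fin N) (AdeleRing (𝓞 L) L))) :=
    (isClosed_adelicUnitaryGroup L H).isClosedEmbedding_subtypeVal
  have k₁ : HasCompactSupport fun g : adelicUnitaryGroup L H => ((η₁ (g : GL (Fin N) (AdeleRing (𝓞 L) L))) : ℂ) :=
    (h₁.hasCompactSupport.comp_isClosedEmbedding hemb).comp_left Complex.ofReal_zero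
  have k₂ : HasCompactSupport fun g : adelicUnitaryGroup L H => ((η₂ (g : GL (Fin N) (AdeleRing (𝓞 L) L))) : ℂ) * Complex.I :=
    ((h₂.hasCompactSupport.comp_isClosedEmbedding hemb).comp_left Complex.ofReal_zero).mul_right
  have e : f = fun g : adelicUnitaryGroup L H =>
      ((η₁ (g : GL (Fin N) (AdeleRing (𝓞 L) L))) : ℂ) + ((η₂ (g : GL (Fin N) (AdeleRing (𝓞 L) L))) : ℂ) * Complex.I :=
    funext fun g => hf g
  rw [e]
  exact k₁.add k₂

/-- The zero function is a test function. [cite: Garrett2018, §6.3] -/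
theorem zero : IsTestFunction L N H (0 : (cmDatum L N H).Adelic → ℂ) := by
  have h0 : IsTestFunctionGL N L (0 : (AdelicGroupData.gl N L).Adelic → ℝ) := by
    refine ⟨continuous_const, ?_, ?_, ⟨_, glIntegralLevel_mem_finiteLevelsGL N L (isCompact_glFiniteIntegralLevel_holds N L),
      fun _ _ _ => rfl⟩⟩
    · exact HasCompactSupport.of_support_subset_isCompact isCompact_empty (fun x hx => hx rfl)
    · have e : (fun g : (AdelicGroupData.gl N L).Adelic =>
          (((0 : (AdelicGroupData.gl N L).Adelic → ℝ) g : ℝ) : ℂ)) = 0 := by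
        funext g; simp
      have h : IsArchSmooth (AutomorphyDatum.gl N L (isCompact_glFiniteIntegralLevel_holds N L)).ofArch
          (0 : (AdelicGroupData.gl N L).Adelic → ℂ) :=
        (archSmooth _).zero_mem
      rw [← e] at h
      exact h
  exact ⟨0, 0, h0, h0, fun g => show (0 : ℂ) = ((0 : ℝ) : ℂ) + ((0 : ℝ) : ℂ) * Complex.I by simp⟩

/-- Sums of test functions are test functions (★ `IsTestFunctionGL.add`). [cite: Garrett2018, §6.3] -/
theorem add {f f' : (cmDatum L N H).Adelic → ℂ} (hf : IsTestFunction L N H f) (hf' : IsTestFunction L N H f') :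
    IsTestFunction L N H (f + f') := by
  obtain ⟨η₁, η₂, h₁, h₂, hf⟩ := hf
  obtain ⟨η₁', η₂', h₁', h₂', hf'⟩ := hf'
  refine ⟨η₁ + η₁', η₂ + η₂', h₁.add h₁', h₂.add h₂', fun g => ?_⟩
  simp only [Pi.add_apply, hf g, hf' g, Complex.ofReal_add]
  ring

/-- Complex scalar multiples of test functions are test functions (`a·f` has real part `Re a · η₁ − Im a · η₂` and imaginary part
`Re a · η₂ + Im a · η₁`; ★ `IsTestFunctionGL.const_mul`, `.add`). [cite: Garrett2018, §6.3] -/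
theorem const_mul {f : (cmDatum L N H).Adelic → ℂ} (hf : IsTestFunction L N H f) (a : ℂ) :
    IsTestFunction L N H (fun g => a * f g) := by
  obtain ⟨η₁, η₂, h₁, h₂, hf⟩ := hf
  refine ⟨fun g => a.re * η₁ g + (-a.im) * η₂ g, fun g => a.re * η₂ g + a.im * η₁ g,
    (h₁.const_mul a.re).add (h₂.const_mul (-a.im)), (h₂.const_mul a.re).add (h₁.const_mul a.im), fun g => ?_⟩
  show a * f g = (((a.re * η₁ (g : GL (Fin N) (AdeleRing (𝓞 L) L)) + (-a.im) * η₂ (g : GL (Fin N) (AdeleRing (𝓞 L) L)) : ℝ)) : ℂ) +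
    (((a.re * η₂ (g : GL (Fin N) (AdeleRing (𝓞 L) L)) + a.im * η₁ (g : GL (Fin N) (AdeleRing (𝓞 L) L)) : ℝ)) : ℂ) * Complex.I
  rw [hf g]
  apply Complex.ext <;> simp [Complex.add_re, Complex.add_im, Complex.mul_re, Complex.mul_im]
  ring

/-- Negatives of test functions are test functions. [cite: Garrett2018, §6.3] -/
theorem neg {f : (cmDatum L N H).Adelic → ℂ} (hf : IsTestFunction L N H f) : IsTestFunction L N H (-f) := by
  have h := hf.const_mul (-1)
  have e : (fun g => (-1 : ℂ) * f g) = -f := by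
    funext g
    show (-1 : ℂ) * f g = (-f) g
    rw [Pi.neg_apply, neg_one_mul]
  rwa [e] at h

end IsTestFunction

/-! ## §2 Pure tensors (factorizable test data) -/

/-- **`PureTensor L N H` — FACTORIZABLE test data on `U(H)(𝔸_{L⁺})`** ([Rogawski1990] §14.2: `f′ = ⊗ f′_v` with `f′_v` the
characteristic function of a hyperspecial compact open subgroup for almost all `v`): a finite BAD SET `S` of finite places of `L⁺`,
UNRAMIFIED LEVELS `K v ≤ U(H)(L⁺_v)` (data: the consumer's hyperspecial ∕ integral stabilisers — no per-place integral-level token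
exists in the tree's `(cmDatum L N H).Local v` yet), LOCAL FACTORS `loc v : U(H)(L⁺_v) → ℂ` which OFF `S` are the indicators of `K v`,
and an ARCHIMEDEAN FACTOR `arch : U(H)(L⁺ ⊗ ℝ) → ℂ` (★ `UnitaryGroup.arch`, read through ★ `archPart : g ↦ g_∞`).
[cite: Rogawski1990, §14.2 p. 233] [cite: BorelJacquet1979, §4.1] -/
structure PureTensor : Type where
  /-- the finite bad set of finite places of `L⁺` -/
  S : Finset (HeightOneSpectrum (𝓞 ↥(maximalRealSubfield L)))
  /-- the unramified levels `K_v ≤ U(H)(L⁺_v)` (intended: hyperspecial ∕ integral stabilisers) -/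
  K : ∀ v : HeightOneSpectrum (𝓞 ↥(maximalRealSubfield L)), Subgroup ((cmDatum L N H).Local v)
  /-- the local factors `f_v : U(H)(L⁺_v) → ℂ` -/
  loc : ∀ v : HeightOneSpectrum (𝓞 ↥(maximalRealSubfield L)), (cmDatum L N H).Local v → ℂ
  /-- the archimedean factor `f_∞ : U(H)(L⁺ ⊗ ℝ) → ℂ` -/
  arch : arch (↥(maximalRealSubfield L)) L (IsCMField.complexConj L) N H → ℂ
  /-- off the bad set the local factor is the indicator of the unramified level -/
  loc_eq_indicator : ∀ v ∉ S, loc v = (K v : Set ((cmDatum L N H).Local v)).indicator fun _ => 1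

namespace PureTensor

variable {L N H}

/-- **Evaluation of a pure tensor**: `eval T g = 1_{∀ v ∉ S, g_v ∈ K v} · f_∞(g_∞) · ∏_{v ∈ S} f_v(g_v)` — the restricted product of the
local factors (off `S` each factor is `1` on `K v` and `0` off it). [cite: Rogawski1990, §14.2 p. 233] [cite: BorelJacquet1979, §4.1] -/
def eval (T : PureTensor L N H) (g : (cmDatum L N H).Adelic) : ℂ :=
  if ∀ v ∉ T.S, (cmDatum L N H).toLocal v g ∈ T.K v then
    T.arch (archPart (↥(maximalRealSubfield L)) L (IsCMField.complexConj L) N H g) *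
      ∏ v ∈ T.S, T.loc v ((cmDatum L N H).toLocal v g)
  else 0

/-- On the elements unramified off `S`, `eval` is the archimedean factor times the FINITE product of the local factors over `S`.
[cite: Rogawski1990, §14.2 p. 233] -/
theorem eval_eq_of_forall_mem (T : PureTensor L N H) (g : (cmDatum L N H).Adelic)
    (hg : ∀ v ∉ T.S, (cmDatum L N H).toLocal v g ∈ T.K v) :
    T.eval g = T.arch (archPart (↥(maximalRealSubfield L)) L (IsCMField.complexConj L) N H g) *
      ∏ v ∈ T.S, T.loc v ((cmDatum L N H).toLocal v g) := by
  rw [eval, if_pos hg]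

/-- Off the unramified elements `eval` vanishes (some local factor off `S` is `0`). [cite: Rogawski1990, §14.2 p. 233] -/
theorem eval_eq_zero_of_not_mem (T : PureTensor L N H) (g : (cmDatum L N H).Adelic)
    {v : HeightOneSpectrum (𝓞 ↥(maximalRealSubfield L))} (hv : v ∉ T.S) (hg : (cmDatum L N H).toLocal v g ∉ T.K v) :
    T.eval g = 0 := by
  have h : ¬ ∀ w ∉ T.S, (cmDatum L N H).toLocal w g ∈ T.K w := fun h => hg (h v hv)
  rw [eval, if_neg h]

/-- The local factor off `S` is `1` on the unramified level … [cite: Rogawski1990, §14.2 p. 233] -/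
theorem loc_apply_of_mem (T : PureTensor L N H) {v : HeightOneSpectrum (𝓞 ↥(maximalRealSubfield L))} (hv : v ∉ T.S)
    {k : (cmDatum L N H).Local v} (hk : k ∈ T.K v) : T.loc v k = 1 := by
  rw [T.loc_eq_indicator v hv]
  exact Set.indicator_of_mem hk _

/-- … and `0` off it. [cite: Rogawski1990, §14.2 p. 233] -/
theorem loc_apply_of_not_mem (T : PureTensor L N H) {v : HeightOneSpectrum (𝓞 ↥(maximalRealSubfield L))} (hv : v ∉ T.S)
    {k : (cmDatum L N H).Local v} (hk : k ∉ T.K v) : T.loc v k = 0 := by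
  rw [T.loc_eq_indicator v hv]
  exact Set.indicator_of_notMem hk _

end PureTensor

/-! ## §3 Local transfer away from the bad places (a RELATION between pure tensors on two forms) -/

/-- **`LocalTransferAway ψ T T′ S₀bad` — `f′_v = f_v` away from the bad places.**  For two forms `H`, `H′ ∈ M_N(L)` (the inner form
`G′ = U(H′)` and the group `G = U(H)`), local identifications `ψ v : U(H)(L⁺_v) ≃ U(H′)(L⁺_v)` at every finite place, pure tensors `T`
on `U(H)` and `T′` on `U(H′)`, and a finite set `S₀bad` of finite places: for every `v ∉ S₀bad`, `T′.loc v = T.loc v ∘ (ψ v)⁻¹`.  This is the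
MATCHING of local factors «for `v ∉ S₀ ∪ S` … we have identified `G′_v` and `G_v` … `f_v = f′_v`» of [Rogawski1990] §14.2 p. 233, as a
closed `Prop` (nothing at the bad places or at infinity: the transfer-factor layer is elsewhere). [cite: Rogawski1990, §14.2 p. 233] -/
def LocalTransferAway {H H' : Matrix (Fin N) (Fin N) L}
    (ψ : ∀ v : HeightOneSpectrum (𝓞 ↥(maximalRealSubfield L)), (cmDatum L N H).Local v ≃ₜ* (cmDatum L N H').Local v)
    (T : PureTensor L N H) (T' : PureTensor L N H') (S₀bad : Finset (HeightOneSpectrum (𝓞 ↥(maximalRealSubfield L)))) : Prop :=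
  ∀ v ∉ S₀bad, T'.loc v = T.loc v ∘ (ψ v).symm

/-- Unfolding of `LocalTransferAway`. [cite: Rogawski1990, §14.2 p. 233] -/
theorem localTransferAway_iff {H H' : Matrix (Fin N) (Fin N) L}
    (ψ : ∀ v : HeightOneSpectrum (𝓞 ↥(maximalRealSubfield L)), (cmDatum L N H).Local v ≃ₜ* (cmDatum L N H').Local v)
    (T : PureTensor L N H) (T' : PureTensor L N H') (S₀bad : Finset (HeightOneSpectrum (𝓞 ↥(maximalRealSubfield L)))) :
    LocalTransferAway L N ψ T T' S₀bad ↔ ∀ v ∉ S₀bad, ∀ k, T'.loc v k = T.loc v ((ψ v).symm k) := by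
  simp only [LocalTransferAway, funext_iff, Function.comp_apply]

/-! ## §4 (edition 2) Unramified pure tensors, smooth factors — the hypotheses of «pure tensors are test functions» -/

namespace PureTensor

variable {L N H}

/-- **`T.IsUnramified`** — off the bad set `S` the level `K v` of the pure tensor IS the local integral level
`U(H)(𝒪_v) = cmLocalIntegralLevel L N H v` (★ `LocalUnitaryIntegralLevel`), so that `f_v = 1_{U(H)(𝒪_v)}` for every `v ∉ S` — the
condition «`f′_v` is the characteristic function of a hyperspecial maximal compact subgroup for almost all `v`» of [Rogawski1990] §14.2
(for almost all `v` the integral level is hyperspecial; the finitely many exceptions are absorbed into `S`).  This is the honesty clause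
edition 1 could not state (its `K` is an abstract field); it UNFOLDS (by `Iff.rfl`) to the hypothesis
`hK : ∀ v ∉ T.S, T.K v = cmLocalIntegralLevel L N H v` of ★ `UnitaryGroupPureTensorContinuity` (`PureTensor.continuous_eval`,
`hasCompactSupport_eval`, `toCc`; F0P3a-p03 (g0), p794754), which imports this file. [cite: Rogawski1990, §14.2 p. 233]
[cite: PlatonovRapinchuk1994, §5.1] -/
def IsUnramified (T : PureTensor L N H) : Prop :=
  ∀ v ∉ T.S, T.K v = cmLocalIntegralLevel L N H v

/-- Off `S` an unramified tensor's level is `U(H)(𝒪_v)`. [cite: Rogawski1990, §14.2 p. 233] -/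
theorem IsUnramified.K_eq {T : PureTensor L N H} (hT : T.IsUnramified)
    {v : HeightOneSpectrum (𝓞 ↥(maximalRealSubfield L))} (hv : v ∉ T.S) : T.K v = cmLocalIntegralLevel L N H v :=
  hT v hv

/-- Off `S` an unramified tensor's level is compact … [cite: PlatonovRapinchuk1994, §5.1] -/
theorem IsUnramified.isCompact_K {T : PureTensor L N H} (hT : T.IsUnramified)
    {v : HeightOneSpectrum (𝓞 ↥(maximalRealSubfield L))} (hv : v ∉ T.S) :
    IsCompact (T.K v : Set ((cmDatum L N H).Local v)) := by
  rw [hT v hv]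
  exact (isCompact_isOpen_cmLocalIntegralLevel L N H v).1

/-- … and open. [cite: PlatonovRapinchuk1994, §5.1] -/
theorem IsUnramified.isOpen_K {T : PureTensor L N H} (hT : T.IsUnramified)
    {v : HeightOneSpectrum (𝓞 ↥(maximalRealSubfield L))} (hv : v ∉ T.S) :
    IsOpen (T.K v : Set ((cmDatum L N H).Local v)) := by
  rw [hT v hv]
  exact (isCompact_isOpen_cmLocalIntegralLevel L N H v).2

/-- … hence closed (an open subgroup is closed). [cite: PlatonovRapinchuk1994, §5.1] -/
theorem IsUnramified.isClosed_K {T : PureTensor L N H} (hT : T.IsUnramified)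
    {v : HeightOneSpectrum (𝓞 ↥(maximalRealSubfield L))} (hv : v ∉ T.S) :
    IsClosed (T.K v : Set ((cmDatum L N H).Local v)) :=
  (T.K v).isClosed_of_isOpen (hT.isOpen_K hv)

/-- Off `S` the local factor of an unramified tensor is `1_{U(H)(𝒪_v)}`. [cite: Rogawski1990, §14.2 p. 233] -/
theorem IsUnramified.loc_eq {T : PureTensor L N H} (hT : T.IsUnramified)
    {v : HeightOneSpectrum (𝓞 ↥(maximalRealSubfield L))} (hv : v ∉ T.S) :
    T.loc v = (cmLocalIntegralLevel L N H v : Set ((cmDatum L N H).Local v)).indicator fun _ => 1 := by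
  rw [T.loc_eq_indicator v hv, hT v hv]

/-- **`T.IsFinSmooth`** — at the BAD places the local factors are smooth in the non-archimedean sense: locally constant with compact
support, `f_v ∈ C_c^∞(U(H)(L⁺_v))` for `v ∈ S` ([Rogawski1990] §14.2: `f′ = ⊗ f′_v ∈ C_c^∞(G′(𝔸))`; [BorelJacquet1979] §4.1).
[cite: Rogawski1990, §14.2 p. 233] [cite: BorelJacquet1979, §4.1] -/
def IsFinSmooth (T : PureTensor L N H) : Prop :=
  ∀ v ∈ T.S, IsLocallyConstant (T.loc v) ∧ HasCompactSupport (T.loc v)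

/-- The indicator of a clopen set is locally constant (elementary). [folklore] -/
private theorem isLocallyConstant_indicator_one {X : Type*} [TopologicalSpace X] {U : Set X} (hUo : IsOpen U)
    (hUc : IsClosed U) : IsLocallyConstant (U.indicator fun _ => (1 : ℂ)) := by
  rw [IsLocallyConstant.iff_exists_open]
  intro y
  by_cases hy : y ∈ U
  · exact ⟨U, hUo, hy, fun z hz => by rw [Set.indicator_of_mem hz, Set.indicator_of_mem hy]⟩
  · exact ⟨Uᶜ, hUc.isOpen_compl, hy, fun z hz => by rw [Set.indicator_of_notMem hz, Set.indicator_of_notMem hy]⟩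

/-- EVERY local factor of an unramified, finitely-smooth tensor is locally constant (on `S` by hypothesis, off `S` as the indicator
of the compact open `U(H)(𝒪_v)`). [cite: Rogawski1990, §14.2 p. 233] -/
theorem isLocallyConstant_loc {T : PureTensor L N H} (hT : T.IsUnramified) (hS : T.IsFinSmooth)
    (v : HeightOneSpectrum (𝓞 ↥(maximalRealSubfield L))) : IsLocallyConstant (T.loc v) := by
  by_cases hv : v ∈ T.S
  · exact (hS v hv).1
  · rw [hT.loc_eq hv, ← hT.K_eq hv]
    exact isLocallyConstant_indicator_one (hT.isOpen_K hv) (hT.isClosed_K hv)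

/-- EVERY local factor of an unramified, finitely-smooth tensor has compact support. [cite: Rogawski1990, §14.2 p. 233] -/
theorem hasCompactSupport_loc {T : PureTensor L N H} (hT : T.IsUnramified) (hS : T.IsFinSmooth)
    (v : HeightOneSpectrum (𝓞 ↥(maximalRealSubfield L))) : HasCompactSupport (T.loc v) := by
  by_cases hv : v ∈ T.S
  · exact (hS v hv).2
  · rw [hT.loc_eq hv, ← hT.K_eq hv]
    exact HasCompactSupport.intro' (hT.isCompact_K hv) (hT.isClosed_K hv) fun x hx => Set.indicator_of_notMem hx _

/-- EVERY local factor of an unramified, finitely-smooth tensor is continuous. [cite: BorelJacquet1979, §4.1] -/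
theorem continuous_loc {T : PureTensor L N H} (hT : T.IsUnramified) (hS : T.IsFinSmooth)
    (v : HeightOneSpectrum (𝓞 ↥(maximalRealSubfield L))) : Continuous (T.loc v) :=
  (isLocallyConstant_loc hT hS v).continuous

open scoped Matrix.Norms.Operator in
/-- **`T.IsArchTest`** — the ARCHIMEDEAN factor `f_∞ : U(H)(L⁺ ⊗ ℝ) → ℂ` is a test function on the real group, read BY RESTRICTION exactly
as in §1: there is `φ : GL_N(L ⊗_ℚ ℝ) → ℂ` continuous, compactly supported and smooth under right translations (`X ↦ φ (g · exp X)` is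
`C^∞` on `𝔤𝔩_N(L ⊗ ℝ)` for every `g` — ★ `IsArchSmooth` for the full real matrix group ★ `archGroupGL N L`) whose restriction along the
CLOSED subgroup `U(H)(L⁺ ⊗ ℝ) = arch … ≤ GL_N(L ⊗ ℝ)` (★ `isClosed_arch`) is `f_∞` ([Rogawski1990] §14.2: `f′_∞ ∈ C_c^∞(G′_∞)`;
[BorelJacquet1979] §4.1; [Garrett2018] §6.3).  (Every smooth compactly supported function on the closed embedded subgroup is such a
restriction; consumers only use members as hypotheses.) [cite: Rogawski1990, §14.2 p. 233] [cite: BorelJacquet1979, §4.1]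
[cite: Garrett2018, §6.3] -/
def IsArchTest (T : PureTensor L N H) : Prop :=
  ∃ φ : GL (Fin N) (NumberField.mixedEmbedding.mixedSpace L) → ℂ, Continuous φ ∧ HasCompactSupport φ ∧
    IsArchSmooth (archGroupGL N L).carrier.subtype φ ∧
    ∀ k : UnitaryGroup.arch (↥(maximalRealSubfield L)) L (IsCMField.complexConj L) N H, T.arch k = φ (k : GL (Fin N) (NumberField.mixedEmbedding.mixedSpace L))

/-- The archimedean factor of an `IsArchTest` tensor is continuous. [cite: BorelJacquet1979, §4.1] -/
theorem IsArchTest.continuous_arch {T : PureTensor L N H} (hT : T.IsArchTest) : Continuous T.arch := by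
  obtain ⟨φ, hφc, -, -, hφ⟩ := hT
  have e : T.arch = fun k : UnitaryGroup.arch (↥(maximalRealSubfield L)) L (IsCMField.complexConj L) N H =>
      φ (k : GL (Fin N) (NumberField.mixedEmbedding.mixedSpace L)) := funext hφ
  rw [e]
  exact hφc.comp continuous_subtype_val

/-- The archimedean factor of an `IsArchTest` tensor has compact support (restriction along the CLOSED embedding
`U(H)(L⁺ ⊗ ℝ) ↪ GL_N(L ⊗ ℝ)`, ★ `isClosed_arch`). [cite: BorelJacquet1979, §4.1] -/
theorem IsArchTest.hasCompactSupport_arch {T : PureTensor L N H} (hT : T.IsArchTest) : HasCompactSupport T.arch := by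
  obtain ⟨φ, -, hφs, -, hφ⟩ := hT
  have e : T.arch = φ ∘ (fun k : UnitaryGroup.arch (↥(maximalRealSubfield L)) L (IsCMField.complexConj L) N H =>
      (k : GL (Fin N) (NumberField.mixedEmbedding.mixedSpace L))) := funext hφ
  rw [e]
  exact hφs.comp_isClosedEmbedding
    (Topology.IsClosedEmbedding.subtypeVal (isClosed_arch (↥(maximalRealSubfield L)) L (IsCMField.complexConj L) N H))

/-- **`T.IsTest`** — the conjunction `IsUnramified ∧ IsFinSmooth ∧ IsArchTest`: the pure tensor is `⊗_v f_v` with `f_v ∈ C_c^∞(G_v)` for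
all `v` and `f_v = 1_{U(H)(𝒪_v)}` off `S` ([Rogawski1990] §14.2 p. 233).  The theorem «`T.IsTest → IsTestFunction L N H T.eval`» is the
provers' (restricted-product continuity of `eval` + extension from the closed subgroup); it is NOT stated here.
[cite: Rogawski1990, §14.2 p. 233] [cite: BorelJacquet1979, §4.1] -/
def IsTest (T : PureTensor L N H) : Prop :=
  T.IsUnramified ∧ T.IsFinSmooth ∧ T.IsArchTest

/-- Projections of `IsTest`. [cite: Rogawski1990, §14.2 p. 233] -/
theorem IsTest.isUnramified {T : PureTensor L N H} (hT : T.IsTest) : T.IsUnramified := hT.1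

/-- Projections of `IsTest`. [cite: Rogawski1990, §14.2 p. 233] -/
theorem IsTest.isFinSmooth {T : PureTensor L N H} (hT : T.IsTest) : T.IsFinSmooth := hT.2.1

/-- Projections of `IsTest`. [cite: Rogawski1990, §14.2 p. 233] -/
theorem IsTest.isArchTest {T : PureTensor L N H} (hT : T.IsTest) : T.IsArchTest := hT.2.2

variable (L N H) in
/-- **Smart constructor `ofUnramified S locS f∞`** — the pure tensor with bad set `S`, levels := the INTEGRAL levels `U(H)(𝒪_v)` at every
`v`, local factors `locS v` on `S` and `1_{U(H)(𝒪_v)}` off `S`, archimedean factor `f∞`; it is `IsUnramified` by construction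
(`ofUnramified_isUnramified`). [cite: Rogawski1990, §14.2 p. 233] -/
def ofUnramified (S : Finset (HeightOneSpectrum (𝓞 ↥(maximalRealSubfield L))))
    (locS : ∀ v : HeightOneSpectrum (𝓞 ↥(maximalRealSubfield L)), (cmDatum L N H).Local v → ℂ)
    (f : UnitaryGroup.arch (↥(maximalRealSubfield L)) L (IsCMField.complexConj L) N H → ℂ) : PureTensor L N H where
  S := S
  K := fun v => cmLocalIntegralLevel L N H v
  loc := fun v => if v ∈ S then locS v else (cmLocalIntegralLevel L N H v : Set ((cmDatum L N H).Local v)).indicator fun _ => 1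
  arch := f
  loc_eq_indicator := fun v hv => by simp only [if_neg hv]

/-- `ofUnramified` is unramified (definitionally). [cite: Rogawski1990, §14.2 p. 233] -/
theorem ofUnramified_isUnramified (S : Finset (HeightOneSpectrum (𝓞 ↥(maximalRealSubfield L))))
    (locS : ∀ v : HeightOneSpectrum (𝓞 ↥(maximalRealSubfield L)), (cmDatum L N H).Local v → ℂ)
    (f : UnitaryGroup.arch (↥(maximalRealSubfield L)) L (IsCMField.complexConj L) N H → ℂ) :
    (ofUnramified L N H S locS f).IsUnramified :=
  fun _ _ => rfl

/-- The bad set of `ofUnramified S …` is `S`. [cite: Rogawski1990, §14.2 p. 233] -/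
@[simp] theorem ofUnramified_S (S : Finset (HeightOneSpectrum (𝓞 ↥(maximalRealSubfield L))))
    (locS : ∀ v : HeightOneSpectrum (𝓞 ↥(maximalRealSubfield L)), (cmDatum L N H).Local v → ℂ)
    (f : UnitaryGroup.arch (↥(maximalRealSubfield L)) L (IsCMField.complexConj L) N H → ℂ) :
    (ofUnramified L N H S locS f).S = S := rfl

/-- On `S` the local factor of `ofUnramified S locS …` is `locS v`. [cite: Rogawski1990, §14.2 p. 233] -/
theorem ofUnramified_loc_of_mem {S : Finset (HeightOneSpectrum (𝓞 ↥(maximalRealSubfield L)))}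
    (locS : ∀ v : HeightOneSpectrum (𝓞 ↥(maximalRealSubfield L)), (cmDatum L N H).Local v → ℂ)
    (f : UnitaryGroup.arch (↥(maximalRealSubfield L)) L (IsCMField.complexConj L) N H → ℂ)
    {v : HeightOneSpectrum (𝓞 ↥(maximalRealSubfield L))} (hv : v ∈ S) :
    (ofUnramified L N H S locS f).loc v = locS v := by
  show (if v ∈ S then locS v else _) = locS v
  rw [if_pos hv]

/-- `ofUnramified S locS f∞` is finitely smooth as soon as the given bad factors are. [cite: BorelJacquet1979, §4.1] -/
theorem ofUnramified_isFinSmooth {S : Finset (HeightOneSpectrum (𝓞 ↥(maximalRealSubfield L)))}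
    {locS : ∀ v : HeightOneSpectrum (𝓞 ↥(maximalRealSubfield L)), (cmDatum L N H).Local v → ℂ}
    (f : UnitaryGroup.arch (↥(maximalRealSubfield L)) L (IsCMField.complexConj L) N H → ℂ)
    (h : ∀ v ∈ S, IsLocallyConstant (locS v) ∧ HasCompactSupport (locS v)) :
    (ofUnramified L N H S locS f).IsFinSmooth := by
  intro v hv
  have hv' : v ∈ S := hv
  rw [ofUnramified_loc_of_mem locS f hv']
  exact h v hv'

end PureTensor

end Literature.NumberTheory.Automorphic.UnitaryGroup

end
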